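import Literature.AlgebraicGeometry.Frobenioids.PadicKummerLocalField
import Literature.AlgebraicGeometry.Frobenioids.PadicKummerContextIso
import HarnessLib

/-!
# Frobenioids II, Theorem 2.4 (i): the context isomorphism induced by an isomorphism of the
# field data (the "geometric" case of `Ψ`), at the Galois / local-field binding

Mochizuki, *The geometry of Frobenioids II*, Kyushu J. Math. **62** (2008) 401–460, §2, Theorem 2.4
pp. 19–20 [cite: MochizukiFrdII2008, Thm 2.4 (i) p.19]: `Ψ` induces "an outer isomorphism of
topological groups `G₁ ⥲ G₂`" mapping `H₁` onto `H₂` and isomorphisms "`O^□(A₁) ⥲ O^□(A₂)`,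
`(H₁)_{A₁} ⥲ (H₂)_{A₂}`, …".

Seat abc-iut-L1-d4 (gen 2), assigned by abc-iut-L1-t7 (gen 2) (INBOX 21:44:16Z; one writer of the
bindings `ofGalois`/`ofGaloisQuot`/`ofLocalField` and of the notion `Def22Context.Iso`). This file
CONSTRUCTS context isomorphisms (`Def22Context.Iso`, `PadicKummerContextIso.lean`) between two
Galois-level contexts `ofGaloisQuot L₁ H₁ … O₁`, `ofGaloisQuot L₂ H₂ … O₂` over DIFFERENT base
fields from an isomorphism of the field data: `φ₀ : K₁ ≃ K₂` with an extension
`φ : K̄₁ ≃ K̄₂` of it to the algebraic closures, carrying `L₁` onto `L₂` and `H₁` onto `H₂`, plus an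
`O^□`-isomorphism equivariant along the induced `Gal(L₁/K₁) ⥲ Gal(L₂/K₂)` (`Iso.ofFieldIso`); and,
for abc-iut-L1-t7's arithmetic contexts `ofLocalField Lᵢ Hᵢ … Sᵢ` (`O^□(Aᵢ) = O^□_{Lᵢ}` a
`Gal`-stable submonoid of `Lᵢ`), the `O^□`-isomorphism is induced by `φ` as well (`Iso.ofLocalField`,
given that `φ` carries `S₁` onto `S₂`). Ingredients proved here: conjugation of `K`-automorphism
groups along a semilinear field isomorphism (`semiConj`), its continuity for the Krull topologies
on absolute Galois groups (`continuous_galConj`; preimage of `Gal(K̄₂/E)` contains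
`Gal(K̄₁/φ⁻¹E)`, `φ⁻¹E` finite over `K₁` by `Module.Finite.of_equiv_equiv`), compatibility with the
restrictions `G_{Kᵢ} ↠ Gal(Lᵢ/Kᵢ)` (`resGal_galConj`), and the Galois property transport
(`Algebra.IsSeparable.iff_of_equiv_equiv`). REMARK (honest scope): in Theorem 2.4 the isomorphism
`G₁ ⥲ G₂` induced by a general `Ψ` arises through anabelian reconstruction and need NOT come from a
field isomorphism; that general case is exactly the abstract `Def22Context.Iso` hypothesis of
`PadicKummerSettingProofs.lean`. This file is the field-theoretic ("geometric") sub-case, showing in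
particular that the binding's `Iso` structure is inhabited by every isomorphism of the arithmetic
data. Nothing here concerns [IUTchIII]; no statement of abc-iut-L1-t7 is restated.
-/

noncomputable section

namespace Literature.AlgebraicGeometry.Frobenioids

namespace PadicKummer

open Field IntermediateField
open Literature.NumberTheory.GaloisRepresentations
open Literature.NumberTheory.GaloisRepresentations.LocalWeilDatum

/-! ### Conjugation of automorphism groups along a semilinear isomorphism of algebras -/

section SemiConj

variable {K₁ K₂ : Type} [Field K₁] [Field K₂] (φ₀ : K₁ ≃+* K₂)
  {A₁ A₂ : Type} [CommRing A₁] [CommRing A₂] [Algebra K₁ A₁] [Algebra K₂ A₂]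
  (ψ : A₁ ≃+* A₂) (hψ : ∀ x : K₁, ψ (algebraMap K₁ A₁ x) = algebraMap K₂ A₂ (φ₀ x))

include hψ in
/-- `ψ⁻¹` lies over `φ₀⁻¹`. [cite: MochizukiFrdII2008, Thm 2.4 (i) p.19] -/
theorem symm_algebraMap (y : K₂) : ψ.symm (algebraMap K₂ A₂ y) = algebraMap K₁ A₁ (φ₀.symm y) := by
  apply ψ.injective
  rw [ψ.apply_symm_apply, hψ, φ₀.apply_symm_apply]

/-- `σ ↦ ψ ∘ σ ∘ ψ⁻¹`: a `K₁`-automorphism of `A₁` becomes a `K₂`-automorphism of `A₂` along the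
`φ₀`-semilinear isomorphism `ψ`. [cite: MochizukiFrdII2008, Thm 2.4 (i) p.19] -/
def semiConjFun (σ : A₁ ≃ₐ[K₁] A₁) : A₂ ≃ₐ[K₂] A₂ :=
  AlgEquiv.ofRingEquiv (f := ψ.symm.trans (σ.toRingEquiv.trans ψ)) fun y => by
    show ψ (σ (ψ.symm (algebraMap K₂ A₂ y))) = algebraMap K₂ A₂ y
    rw [symm_algebraMap φ₀ ψ hψ, σ.commutes, hψ, φ₀.apply_symm_apply]

/-- `semiConjFun σ y = ψ (σ (ψ⁻¹ y))`. [cite: MochizukiFrdII2008, Thm 2.4 (i) p.19] -/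
@[simp] theorem semiConjFun_apply (σ : A₁ ≃ₐ[K₁] A₁) (y : A₂) :
    semiConjFun φ₀ ψ hψ σ y = ψ (σ (ψ.symm y)) := rfl

/-- **Conjugation along `ψ`** as an isomorphism of automorphism groups
`Aut_{K₁}(A₁) ⥲ Aut_{K₂}(A₂)`. [cite: MochizukiFrdII2008, Thm 2.4 (i) p.19] -/
def semiConj : (A₁ ≃ₐ[K₁] A₁) ≃* (A₂ ≃ₐ[K₂] A₂) where
  toFun := semiConjFun φ₀ ψ hψ
  invFun := semiConjFun φ₀.symm ψ.symm (symm_algebraMap φ₀ ψ hψ)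
  left_inv σ := AlgEquiv.ext fun x => by
    simp only [semiConjFun_apply, RingEquiv.symm_symm, RingEquiv.symm_apply_apply]
  right_inv σ := AlgEquiv.ext fun y => by
    simp only [semiConjFun_apply, RingEquiv.symm_symm, RingEquiv.apply_symm_apply]
  map_mul' σ τ := AlgEquiv.ext fun y => by
    simp only [semiConjFun_apply, AlgEquiv.mul_apply, RingEquiv.symm_apply_apply]

/-- `semiConj σ y = ψ (σ (ψ⁻¹ y))`. [cite: MochizukiFrdII2008, Thm 2.4 (i) p.19] -/
@[simp] theorem semiConj_apply (σ : A₁ ≃ₐ[K₁] A₁) (y : A₂) :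
    semiConj φ₀ ψ hψ σ y = ψ (σ (ψ.symm y)) := rfl

/-- `semiConj⁻¹ σ' x = ψ⁻¹ (σ' (ψ x))`. [cite: MochizukiFrdII2008, Thm 2.4 (i) p.19] -/
@[simp] theorem semiConj_symm_apply (σ' : A₂ ≃ₐ[K₂] A₂) (x : A₁) :
    (semiConj φ₀ ψ hψ).symm σ' x = ψ.symm (σ' (ψ x)) := rfl

end SemiConj

/-! ### The absolute Galois groups: `G_{K₁} ⥲ G_{K₂}` along `φ : K̄₁ ⥲ K̄₂`, with continuity -/

section AbsGalois

variable {K₁ K₂ : Type} [Field K₁] [Field K₂] (φ₀ : K₁ ≃+* K₂)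
  (φ : AlgebraicClosure K₁ ≃+* AlgebraicClosure K₂)
  (hφ : ∀ x : K₁, φ (algebraMap K₁ (AlgebraicClosure K₁) x) =
    algebraMap K₂ (AlgebraicClosure K₂) (φ₀ x))

/-- `G_{K₁} ⥲ G_{K₂}` (abstract groups), `σ ↦ φ σ φ⁻¹`. [cite: MochizukiFrdII2008, Thm 2.4 (i) p.19] -/
def galConj : absoluteGaloisGroup K₁ ≃* absoluteGaloisGroup K₂ :=
  ((absoluteGaloisGroup.toAlgEquiv K₁).trans (semiConj φ₀ φ hφ)).trans
    (absoluteGaloisGroup.toAlgEquiv K₂).symm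

/-- `galConj σ` acts on `K̄₂` by `y ↦ φ (σ (φ⁻¹ y))`. [cite: MochizukiFrdII2008, Thm 2.4 (i) p.19] -/
@[simp] theorem galConj_smul (σ : absoluteGaloisGroup K₁) (y : AlgebraicClosure K₂) :
    galConj φ₀ φ hφ σ • y = φ (σ • φ.symm y) := rfl

/-- `galConj⁻¹ σ'` acts on `K̄₁` by `x ↦ φ⁻¹ (σ' (φ x))`. [cite: MochizukiFrdII2008, Thm 2.4 (i) p.19] -/
@[simp] theorem galConj_symm_smul (σ' : absoluteGaloisGroup K₂) (x : AlgebraicClosure K₁) :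
    (galConj φ₀ φ hφ).symm σ' • x = φ.symm (σ' • φ x) := rfl

/-- `φ⁻¹ E`, for an intermediate field `E` of `K̄₂/K₂`, as an intermediate field of `K̄₁/K₁`.
[cite: MochizukiFrdII2008, Thm 2.4 (i) p.19] -/
def comapIntermediateField (E : IntermediateField K₂ (AlgebraicClosure K₂)) :
    IntermediateField K₁ (AlgebraicClosure K₁) :=
  (E.toSubfield.comap φ.toRingHom).toIntermediateField fun x => by
    show φ (algebraMap K₁ (AlgebraicClosure K₁) x) ∈ E
    rw [hφ]
    exact E.algebraMap_mem (φ₀ x)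

/-- Membership in `φ⁻¹ E`. [cite: MochizukiFrdII2008, Thm 2.4 (i) p.19] -/
theorem mem_comapIntermediateField_iff (E : IntermediateField K₂ (AlgebraicClosure K₂))
    (x : AlgebraicClosure K₁) : x ∈ comapIntermediateField φ₀ φ hφ E ↔ φ x ∈ E :=
  Iff.rfl

/-- `E ⥲ φ⁻¹ E` as rings (restriction of `φ⁻¹`). [cite: MochizukiFrdII2008, Thm 2.4 (i) p.19] -/
def comapRingEquiv (E : IntermediateField K₂ (AlgebraicClosure K₂)) :
    E ≃+* comapIntermediateField φ₀ φ hφ E where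
  toFun y := ⟨φ.symm y, by rw [mem_comapIntermediateField_iff, RingEquiv.apply_symm_apply]; exact y.2⟩
  invFun x := ⟨φ x, x.2⟩
  left_inv y := Subtype.ext (φ.apply_symm_apply _)
  right_inv x := Subtype.ext (φ.symm_apply_apply _)
  map_mul' a b := Subtype.ext (map_mul φ.symm _ _)
  map_add' a b := Subtype.ext (map_add φ.symm _ _)

/-- `φ⁻¹ E` is finite over `K₁` when `E` is finite over `K₂` (transport along the `φ₀`-semilinear
`E ⥲ φ⁻¹ E`). [cite: MochizukiFrdII2008, Thm 2.4 (i) p.19] -/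
theorem finiteDimensional_comap (E : IntermediateField K₂ (AlgebraicClosure K₂))
    [FiniteDimensional K₂ E] : FiniteDimensional K₁ (comapIntermediateField φ₀ φ hφ E) := by
  refine Module.Finite.of_equiv_equiv φ₀.symm (comapRingEquiv φ₀ φ hφ E) (RingHom.ext fun y => ?_)
  apply Subtype.ext
  show algebraMap K₁ (AlgebraicClosure K₁) (φ₀.symm y) = φ.symm (algebraMap K₂ (AlgebraicClosure K₂) y)
  rw [symm_algebraMap φ₀ φ hφ]

/-- **Continuity of `G_{K₁} ⥲ G_{K₂}` for the Krull topologies**: the preimage of `Gal(K̄₂/E)`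
(`E/K₂` finite) contains `Gal(K̄₁/φ⁻¹E)`. [cite: MochizukiFrdII2008, Thm 2.4 (i) p.19] -/
theorem continuous_galConj : Continuous (galConj φ₀ φ hφ) := by
  apply continuous_of_continuousAt_one _ (continuousAt_def.mpr _)
  intro N hN
  rw [map_one] at hN
  obtain ⟨E, hEfd, hE⟩ := (krullTopology_mem_nhds_one_iff K₂ (AlgebraicClosure K₂) N).mp hN
  haveI := hEfd
  haveI := finiteDimensional_comap φ₀ φ hφ E
  refine (krullTopology_mem_nhds_one_iff K₁ (AlgebraicClosure K₁) _).mpr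
    ⟨comapIntermediateField φ₀ φ hφ E, inferInstance, fun σ hσ => hE ?_⟩
  rw [SetLike.mem_coe, IntermediateField.mem_fixingSubgroup_iff] at hσ
  rw [SetLike.mem_coe, IntermediateField.mem_fixingSubgroup_iff]
  intro y hy
  have h1 := hσ (φ.symm y)
    ((mem_comapIntermediateField_iff φ₀ φ hφ E _).mpr (by rw [RingEquiv.apply_symm_apply]; exact hy))
  show φ (σ (φ.symm y)) = y
  rw [h1, RingEquiv.apply_symm_apply]

include hφ in
/-- `φ⁻¹` lies over `φ₀⁻¹` (for the symmetric construction). [cite: MochizukiFrdII2008, Thm 2.4 (i) p.19] -/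
theorem hφ_symm (y : K₂) : φ.symm (algebraMap K₂ (AlgebraicClosure K₂) y) =
    algebraMap K₁ (AlgebraicClosure K₁) (φ₀.symm y) :=
  symm_algebraMap φ₀ φ hφ y

/-- **`G_{K₁} ⥲ G_{K₂}` as an isomorphism of topological groups** (the representative of the
"outer isomorphism of topological groups `G₁ ⥲ G₂`" when `Ψ` comes from `φ`).
[cite: MochizukiFrdII2008, Thm 2.4 (i) p.19] -/
def galConjₜ : absoluteGaloisGroup K₁ ≃ₜ* absoluteGaloisGroup K₂ :=
  { galConj φ₀ φ hφ with
    continuous_toFun := continuous_galConj φ₀ φ hφ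
    continuous_invFun := by
      convert continuous_galConj φ₀.symm φ.symm (hφ_symm φ₀ φ hφ) using 1
      exact funext fun _ => rfl }

/-- `galConjₜ` is `galConj` on elements. [cite: MochizukiFrdII2008, Thm 2.4 (i) p.19] -/
@[simp] theorem galConjₜ_apply (σ : absoluteGaloisGroup K₁) : galConjₜ φ₀ φ hφ σ = galConj φ₀ φ hφ σ :=
  rfl

end AbsGalois

/-! ### The finite level: `Gal(L₁/K₁) ⥲ Gal(L₂/K₂)` and the restriction square -/

section Finite

variable {K₁ K₂ : Type} [Field K₁] [Field K₂] (φ₀ : K₁ ≃+* K₂)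
  (φ : AlgebraicClosure K₁ ≃+* AlgebraicClosure K₂)
  (hφ : ∀ x : K₁, φ (algebraMap K₁ (AlgebraicClosure K₁) x) =
    algebraMap K₂ (AlgebraicClosure K₂) (φ₀ x))
  (L₁ : IntermediateField K₁ (AlgebraicClosure K₁)) (L₂ : IntermediateField K₂ (AlgebraicClosure K₂))
  (hL : ∀ y : AlgebraicClosure K₁, y ∈ L₁ ↔ φ y ∈ L₂)

/-- `φ|_{L₁} : L₁ ⥲ L₂` as rings. [cite: MochizukiFrdII2008, Thm 2.4 (i) p.19] -/
def fieldIsoL : L₁ ≃+* L₂ where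
  toFun x := ⟨φ x, (hL x).mp x.2⟩
  invFun y := ⟨φ.symm y, (hL _).mpr (by rw [RingEquiv.apply_symm_apply]; exact y.2)⟩
  left_inv x := Subtype.ext (φ.symm_apply_apply _)
  right_inv y := Subtype.ext (φ.apply_symm_apply _)
  map_mul' a b := Subtype.ext (map_mul φ _ _)
  map_add' a b := Subtype.ext (map_add φ _ _)

/-- `fieldIsoL` on elements. [cite: MochizukiFrdII2008, Thm 2.4 (i) p.19] -/
@[simp] theorem coe_fieldIsoL (x : L₁) :
    ((fieldIsoL φ L₁ L₂ hL x : L₂) : AlgebraicClosure K₂) = φ x := rfl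

/-- `fieldIsoL⁻¹` on elements. [cite: MochizukiFrdII2008, Thm 2.4 (i) p.19] -/
@[simp] theorem coe_fieldIsoL_symm (y : L₂) :
    (((fieldIsoL φ L₁ L₂ hL).symm y : L₁) : AlgebraicClosure K₁) = φ.symm y := rfl

include hφ in
/-- `fieldIsoL` lies over `φ₀`. [cite: MochizukiFrdII2008, Thm 2.4 (i) p.19] -/
theorem fieldIsoL_algebraMap (x : K₁) :
    fieldIsoL φ L₁ L₂ hL (algebraMap K₁ L₁ x) = algebraMap K₂ L₂ (φ₀ x) :=
  Subtype.ext (hφ x)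

/-- **`Gal(L₁/K₁) ⥲ Gal(L₂/K₂)`** (`= Aut_E((A₁)_E) ⥲ Aut_E((A₂)_E)`), conjugation by `φ|_{L₁}`.
[cite: MochizukiFrdII2008, Thm 2.4 (i) p.19] -/
def galConjL : (L₁ ≃ₐ[K₁] L₁) ≃* (L₂ ≃ₐ[K₂] L₂) :=
  semiConj φ₀ (fieldIsoL φ L₁ L₂ hL) (fieldIsoL_algebraMap φ₀ φ hφ L₁ L₂ hL)

/-- `galConjL τ y = φ (τ (φ⁻¹ y))` on elements of `K̄₂`. [cite: MochizukiFrdII2008, Thm 2.4 (i) p.19] -/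
@[simp] theorem coe_galConjL_apply (τ : L₁ ≃ₐ[K₁] L₁) (y : L₂) :
    ((galConjL φ₀ φ hφ L₁ L₂ hL τ y : L₂) : AlgebraicClosure K₂) =
      φ (τ ((fieldIsoL φ L₁ L₂ hL).symm y) : AlgebraicClosure K₁) := rfl

section GalMonoid

variable (S₁ : StableSubmonoid L₁) (S₂ : StableSubmonoid L₂)
  (hS : ∀ x : L₁, x ∈ S₁.toSubmonoid ↔ fieldIsoL φ L₁ L₂ hL x ∈ S₂.toSubmonoid)

/-- `O^□_{L₁} ⥲ O^□_{L₂}` induced by `φ` ("`Ψ` preserves `O^⊳(−)`" in the field-theoretic case).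
[cite: MochizukiFrdII2008, Thm 2.4 (i) p.20] -/
def galMonoidIso : GalMonoid S₁ ≃* GalMonoid S₂ where
  toFun x := GalMonoid.mk (fieldIsoL φ L₁ L₂ hL x.val) ((hS x.val).mp x.val_mem)
  invFun y := GalMonoid.mk ((fieldIsoL φ L₁ L₂ hL).symm y.val) (by
    have h := hS ((fieldIsoL φ L₁ L₂ hL).symm y.val)
    rw [RingEquiv.apply_symm_apply] at h
    exact h.mpr y.val_mem)
  left_inv x := GalMonoid.ext (by simp)
  right_inv y := GalMonoid.ext (by simp)
  map_mul' x y := GalMonoid.ext (by simp [map_mul])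

/-- `galMonoidIso` on values. [cite: MochizukiFrdII2008, Thm 2.4 (i) p.20] -/
@[simp] theorem val_galMonoidIso (x : GalMonoid S₁) :
    (galMonoidIso φ L₁ L₂ hL S₁ S₂ hS x).val = fieldIsoL φ L₁ L₂ hL x.val := rfl

/-- `galMonoidIso` is equivariant along `Gal(L₁/K₁) ⥲ Gal(L₂/K₂)`.
[cite: MochizukiFrdII2008, Thm 2.4 (i) p.20] -/
theorem galMonoidIso_smul (τ : L₁ ≃ₐ[K₁] L₁) (x : GalMonoid S₁) :
    galMonoidIso φ L₁ L₂ hL S₁ S₂ hS (τ • x) =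
      galConjL φ₀ φ hφ L₁ L₂ hL τ • galMonoidIso φ L₁ L₂ hL S₁ S₂ hS x := by
  apply GalMonoid.ext
  rw [val_galMonoidIso, GalMonoid.val_smul, GalMonoid.val_smul, val_galMonoidIso, AlgEquiv.smul_def,
    AlgEquiv.smul_def, galConjL, semiConj_apply, RingEquiv.symm_apply_apply]

end GalMonoid

variable [Normal K₁ L₁] [Normal K₂ L₂]

/-- **The restriction square**: `Gal(K̄₂/K₂) ↠ Gal(L₂/K₂)` after `galConj` equals `galConjL` after
`Gal(K̄₁/K₁) ↠ Gal(L₁/K₁)` (compatibility of the induced isomorphisms with the outer surjections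
`G ↠ Aut_E(A_E)`). [cite: MochizukiFrdII2008, Thm 2.4 (i) p.19] -/
theorem resGal_galConj (σ : absoluteGaloisGroup K₁) :
    resGal L₂ (galConj φ₀ φ hφ σ) = galConjL φ₀ φ hφ L₁ L₂ hL (resGal L₁ σ) := by
  apply AlgEquiv.ext
  intro y
  apply Subtype.ext
  rw [coe_resGal_apply, galConj_smul, coe_galConjL_apply, coe_resGal_apply, coe_fieldIsoL_symm]

include hφ hL in
/-- The Galois property transports along `(φ₀, φ|_{L₁})` (separability by
`Algebra.IsSeparable.iff_of_equiv_equiv`; normality is assumed on both sides, as in `ofGalois`).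
[cite: MochizukiFrdII2008, Def 2.2 (ii) p.17] -/
theorem isGalois_iff_of_fieldIso : IsGalois K₁ L₁ ↔ IsGalois K₂ L₂ := by
  have hsep : Algebra.IsSeparable K₁ L₁ ↔ Algebra.IsSeparable K₂ L₂ :=
    Algebra.IsSeparable.iff_of_equiv_equiv φ₀ (fieldIsoL φ L₁ L₂ hL)
      (RingHom.ext fun x => (fieldIsoL_algebraMap φ₀ φ hφ L₁ L₂ hL x).symm)
  rw [isGalois_iff, isGalois_iff]
  exact and_congr hsep ⟨fun _ => inferInstance, fun _ => inferInstance⟩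

end Finite

/-! ### The context isomorphisms -/

namespace Def22Context.Iso

variable {K₁ K₂ : Type} [Field K₁] [Field K₂] (φ₀ : K₁ ≃+* K₂)
  (φ : AlgebraicClosure K₁ ≃+* AlgebraicClosure K₂)
  (hφ : ∀ x : K₁, φ (algebraMap K₁ (AlgebraicClosure K₁) x) =
    algebraMap K₂ (AlgebraicClosure K₂) (φ₀ x))
  (L₁ : IntermediateField K₁ (AlgebraicClosure K₁)) (L₂ : IntermediateField K₂ (AlgebraicClosure K₂))
  [Normal K₁ L₁] [FiniteDimensional K₁ L₁] [Normal K₂ L₂] [FiniteDimensional K₂ L₂]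
  (hL : ∀ y : AlgebraicClosure K₁, y ∈ L₁ ↔ φ y ∈ L₂)
  (H₁ : Subgroup (absoluteGaloisGroup K₁)) [H₁.Normal]
  (hH₁ : IsOpen (H₁ : Set (absoluteGaloisGroup K₁)))
  (H₂ : Subgroup (absoluteGaloisGroup K₂)) [H₂.Normal]
  (hH₂ : IsOpen (H₂ : Set (absoluteGaloisGroup K₂)))
  (hH : H₁.map (galConjₜ φ₀ φ hφ).toMulEquiv.toMonoidHom = H₂)

section GaloisQuot

variable (O₁ O₂ : Type) [CommMonoid O₁] [IsCancelMul O₁] [MulDistribMulAction (L₁ ≃ₐ[K₁] L₁) O₁]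
  [CommMonoid O₂] [IsCancelMul O₂] [MulDistribMulAction (L₂ ≃ₐ[K₂] L₂) O₂]
  (ω : O₁ ≃* O₂) (hω : ∀ (τ : L₁ ≃ₐ[K₁] L₁) (x : O₁), ω (τ • x) = galConjL φ₀ φ hφ L₁ L₂ hL τ • ω x)

/-- **The context isomorphism induced by an isomorphism of the field data** (Thm. 2.4 (i), the
case of a `Ψ` of field-theoretic origin), between abc-iut-L1-t7's `ofGaloisQuot` contexts:
`G_{K₁} ⥲ G_{K₂}` and `Gal(L₁/K₁) ⥲ Gal(L₂/K₂)` by conjugation with `φ`, `H₁ ↦ H₂`, and a given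
`O^□`-isomorphism `ω` equivariant along the latter. [cite: MochizukiFrdII2008, Thm 2.4 (i) p.19] -/
def ofFieldIso : Iso (ofGaloisQuot L₁ H₁ hH₁ O₁) (ofGaloisQuot L₂ H₂ hH₂ O₂) where
  isoC := galConjL φ₀ φ hφ L₁ L₂ hL
  isoO := ω
  isoE := galConjL φ₀ φ hφ L₁ L₂ hL
  isoG := galConjₜ φ₀ φ hφ
  res_isoC _ := rfl
  isoO_smul := hω
  outer_isoG σ := resGal_galConj φ₀ φ hφ L₁ L₂ hL σ
  map_H := hH
  isGalois_iff := isGalois_iff_of_fieldIso φ₀ φ hφ L₁ L₂ hL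

end GaloisQuot

section LocalField

variable (S₁ : StableSubmonoid L₁) (S₂ : StableSubmonoid L₂)
  (hS : ∀ x : L₁, x ∈ S₁.toSubmonoid ↔ fieldIsoL φ L₁ L₂ hL x ∈ S₂.toSubmonoid)

/-- **The context isomorphism between two arithmetic contexts `ofLocalField`** (abc-iut-L1-t7's
`Def22Context.ofLocalField Lᵢ Hᵢ … Sᵢ`, `O^□(Aᵢ) = O^□_{Lᵢ}`) induced by an isomorphism of the field
data carrying `S₁` onto `S₂`. [cite: MochizukiFrdII2008, Thm 2.4 (i) p.19] -/
def ofLocalField : Iso (ofLocalField L₁ H₁ hH₁ S₁) (ofLocalField L₂ H₂ hH₂ S₂) :=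
  ofFieldIso φ₀ φ hφ L₁ L₂ hL H₁ hH₁ H₂ hH₂ hH (GalMonoid S₁) (GalMonoid S₂)
    (galMonoidIso φ L₁ L₂ hL S₁ S₂ hS) (galMonoidIso_smul φ₀ φ hφ L₁ L₂ hL S₁ S₂ hS)

end LocalField

end Def22Context.Iso

end PadicKummer

end Literature.AlgebraicGeometry.Frobenioids
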